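import Summits.Ventures.YMGap.Conjectures.StrongCouplingChiralLROSchwingerDysonEstimates
import Summits.Ventures.YMGap.Conjectures.StrongCouplingChiralLROReductionQuantitative
import Literature.MathematicalPhysics.StatisticalMechanics.ComplexSpinSchwingerDysonPerturbed
import HarnessLib
import HarnessLib.Audit.Tags

/-!
# Row S4 of Y3 at small `β > 0` is a theorem, uniformly in the volume; Y3 reduces to the infrared bound

Cell `pub-ymgap`, seat qcd-lit g19 (literature-prover), `bears_on: Q1`; sequel and conclusion of
`…SchwingerDysonSetup` / `…OneLink` / `…Estimates` (the β ≥ 0 Schwinger–Dyson inequalities with the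
plaquette weight) and of `Literature/…/ComplexSpinSchwingerDysonPerturbed` (Lemma 4.7 with perturbed rates).
Everything is a theorem (0 facts).

* `sdLam`, `sdBound` — the rates `λ_j(β) = ((N-j) + 2νκ(β))/(N e^{-βc} - κ(β))` and the explicit constant
  `b(β) = (2N)² (N - 2νκ)/(N e^{βc} K(λ(β)) + κ)`, functions of `N, ν, β` ONLY (`c = linkOsc ν N`,
  `κ = kap N ν β`); `λ_j(0) = 1 - j/N`, `b(0) = (2N)²/K(N)` (Remark 4.6's `K`).
* **`schwingerDyson_bound`** — for `1 ≤ N ≤ 4`, `ν ≥ 1`, EVERY `β ≥ 0` with `κ(β) < N e^{-βc}` and EVERY even `L`: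
  `∑_μ (T_β(e_μ) + T_β(-e_μ)) ≥ b(β)`, `T_β = ssTwoPoint N ν L β 0 0`.
* **`tendsto_sdBound`** — `b(β) → (2N)²/K(N)` as `β → 0`; hence **`schwingerDysonBound_smallBeta`**: for every
  `ε > 0` there is `β₁ = β₁(N, ν, ε) > 0` with (SD)_{β,(2N)²/K(N)-ε} for all `0 ≤ β < β₁` and ALL even `L` —
  row S4 of the census at small `β > 0`, UNIFORMLY IN THE VOLUME, previously "not in print".
* **`salmhoferSeilerSmallBeta_of_infraredBound`** — consequently the typed conjecture `SalmhoferSeilerSmallBeta`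
  (Y3) follows from the volume-uniform infrared bound (IR)_{β,4N+ε} ALONE (row S3: Gaussian domination at
  `β > 0`, the one remaining input without a template in print).

Method (new; Salmhofer–Seiler prove `β = 0`): SD equation at fixed gauge field + pointwise-in-`U` chiral-swap
positivity + one-link resampling with the plaquette weight frozen/unfrozen at cost `e^{±βc}`, `c` volume-free.
[cite: SalmhoferSeiler1991, Lemma 4.7, Thm. 4.8 (4.38)–(4.39), Cor. 4.9 (4.41)–(4.43), §5 p. 424].
-/

noncomputable section

open MeasureTheory Finset
open scoped ComplexConjugate Matrix BigOperators
open Literature.MathematicalPhysics.QuantumFieldTheory (Site Edge GaugeConfig wilsonAction wilsonWeight wilsonMeasure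
  partitionFunction haarProbability)
open Literature.MathematicalPhysics.QuantumLattice
open Literature.MathematicalPhysics.QuantumLattice.GrassmannAlgebra
open Literature.MathematicalPhysics.QuantumLattice.StrongCoupling
open Literature.MathematicalPhysics.QuantumLattice.StaggeredRP (expect definingRep eoParity_torusLinks)
open Literature.MathematicalPhysics.QuantumLattice.StaggeredDeterminant (eoParity)
open Literature.MathematicalPhysics.StatisticalMechanics
open Literature.Probability.LatticeModels (TorusSite)

namespace Summit.Ventures.YMGap.Conjectures

namespace SchwingerDyson

variable {N ν L : ℕ} [NeZero L]

variable [LinearOrder (TorusSite ν L)]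

/-! ### The perturbed rates and the explicit bound -/

variable (N ν) in
/-- **The rates `λ_j(β) = ((N - j) + 2νκ(β)) / (N e^{-βc} - κ(β))`** of (4.35)_β; `λ_j(0) = 1 - j/N`. [cite: SalmhoferSeiler1991, Lemma 4.7 (4.35)] -/
def sdLam (β : ℝ) (j : ℕ) : ℝ :=
  ((N : ℝ) - j + 2 * ν * kap N ν β) / ((N : ℝ) * Real.exp (-β * linkOsc ν N) - kap N ν β)

variable (N ν) in
/-- **The explicit volume-independent Schwinger–Dyson constant `b(β) = (2N)² (N - 2νκ)/(N e^{βc} K(λ(β)) + κ)`**,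
`b(0) = (2N)²/K(N)`. [cite: SalmhoferSeiler1991, Thm. 4.8 (4.38)–(4.39)] -/
def sdBound (β : ℝ) : ℝ :=
  (2 * N : ℝ) ^ 2 * (((N : ℝ) - 2 * ν * kap N ν β) /
    ((N : ℝ) * Real.exp (β * linkOsc ν N) * ComplexSpin.sdKP N (sdLam N ν β) (ComplexSpin.uNLogCoeff N) + kap N ν β))

omit [NeZero L] [LinearOrder (TorusSite ν L)] in
/-- `κ(0) = 0`. [cite: SeilerLNP1982, Ch. 2] -/
theorem kap_zero : kap N ν 0 = 0 := by simp [kap]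

omit [NeZero L] [LinearOrder (TorusSite ν L)] in
/-- `λ_j(0) = 1 - j/N`. [cite: SalmhoferSeiler1991, (4.35)] -/
theorem sdLam_zero (hN : N ≠ 0) : sdLam N ν 0 = ComplexSpin.sdRate N := by
  funext j
  have hN' : (N : ℝ) ≠ 0 := Nat.cast_ne_zero.mpr hN
  rw [sdLam, kap_zero, ComplexSpin.sdRate]
  simp only [mul_zero, add_zero, zero_mul, neg_zero, Real.exp_zero, mul_one, sub_zero]
  field_simp

omit [NeZero L] [LinearOrder (TorusSite ν L)] in
/-- The rates are nonnegative up to `N` when `κ(β) < N e^{-βc}`, `β ≥ 0`. [cite: SalmhoferSeiler1991, (4.35)] -/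
theorem sdLam_nonneg {β : ℝ} (hβ : 0 ≤ β) (hD : kap N ν β < (N : ℝ) * Real.exp (-β * linkOsc ν N)) {j : ℕ} (hj : j ≤ N) :
    0 ≤ sdLam N ν β j := by
  have hκ := kap_nonneg (N := N) (ν := ν) hβ
  have hjN : (j : ℝ) ≤ N := by exact_mod_cast hj
  exact div_nonneg (by nlinarith) (by linarith)

/-! ### Lemma 4.7 at `β ≥ 0` for every bond, and the site identity -/

/-- The `U(N)` weights `w_k` of Remark 4.6 are nonnegative for `1 ≤ k ≤ N ≤ 4`. [cite: SalmhoferSeiler1991, Remark 4.6] -/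
theorem uNLogCoeff_nonneg' (hN4 : N ≤ 4) (i : ℕ) (hi1 : 1 ≤ i) (hiN : i ≤ N) : 0 ≤ ComplexSpin.uNLogCoeff N i := by
  rcases Nat.lt_or_ge i 2 with h | h
  · rw [show i = 1 by omega, ComplexSpin.uNLogCoeff_one]; exact zero_le_one
  · exact ComplexSpin.uNLogCoeff_nonneg hN4 i h hiN

/-- **Lemma 4.7 at `β ≥ 0` (per bond)**: `∑_i i w_i S_β((σσ)_b^i) ≤ K(λ(β)) S_β((σσ)_b)` for every bond `b ∋ x`,
`x` even, `1 ≤ N ≤ 4`, `β ≥ 0` with `κ(β) < N e^{-βc}`. [cite: SalmhoferSeiler1991, Lemma 4.7 and (4.38)–(4.39)] -/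
theorem sum_le_sdKP_bond (hL : Even L) (hN1 : 1 ≤ N) (hN4 : N ≤ 4) {β : ℝ} (hβ : 0 ≤ β)
    (hD : kap N ν β < (N : ℝ) * Real.exp (-β * linkOsc ν N)) {x : TorusSite ν L} (hx : x ∈ evens ν L)
    {e : Edge ν L} (he : e ∈ bondsAt ν L x) :
    ∑ i ∈ Finset.range (N + 1), (i : ℝ) * ComplexSpin.uNLogCoeff N i *
        sdS N ν L β (spinPair (torusLinks ν L e).1 (torusLinks ν L e).2 ^ i) ≤
      ComplexSpin.sdKP N (sdLam N ν β) (ComplexSpin.uNLogCoeff N) *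
        sdS N ν L β (spinPair (torusLinks ν L e).1 (torusLinks ν L e).2) := by
  set w := ComplexSpin.uNLogCoeff N with hw
  have hlog : ComplexSpin.HasLog N (ComplexSpin.uNBondCoeff N) w := ComplexSpin.hasLog_uN hN1 hN4
  have hw1 : w 1 = 1 := ComplexSpin.uNLogCoeff_one N
  have hwk : ∀ k, 2 ≤ k → k ≤ N → 0 ≤ w k := fun k hk2 hkN => ComplexSpin.uNLogCoeff_nonneg hN4 k hk2 hkN
  have hw' : ∀ i, 1 ≤ i → i ≤ N → 0 ≤ w i := uNLogCoeff_nonneg' hN4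
  set T : FermiAlg (TorusSite ν L) N := spinPair (torusLinks ν L e).1 (torusLinks ν L e).2 with hT
  have hS0 : ∀ n, 0 ≤ sdS N ν L β (T ^ n) := fun n => sdS_nonneg hL β (isChiralPositive_spinPair_pow _ _ n)
  have hDpos : 0 < (N : ℝ) * Real.exp (-β * linkOsc ν N) - kap N ν β := by linarith
  have hsd : ∀ j : ℕ, ∑ u ∈ Finset.range (N + 1), (u : ℝ) * w u * sdS N ν L β (T ^ (j + u)) ≤
      sdLam N ν β j * sdS N ν L β (T ^ j) := by
    intro j
    have h := sd_step hL hN1 hβ hD.le hx he hlog hw1 hw' j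
    rw [sdLam, div_mul_eq_mul_div, le_div_iff₀ hDpos, mul_comm]
    exact h
  have h47 : ∀ k, 1 ≤ k → k ≤ N → sdS N ν L β (T ^ k) ≤ ComplexSpin.sdAlphaP (sdLam N ν β) w k * sdS N ν L β (T ^ 1) :=
    fun k hk1 hkN => ComplexSpin.le_sdAlphaP_mul_of_sd hN1 hw1 hwk (fun j hj => sdLam_nonneg hβ hD hj) hS0 hsd hk1 hkN
  have h := ComplexSpin.sum_le_sdKP_mul (N := N) (by rw [hw1]; exact zero_le_one) hwk h47
  rwa [pow_one] at h

omit [LinearOrder (TorusSite ν L)] in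
/-- `0` is an even site. [cite: SalmhoferSeiler1991, §2 (2.8)] -/
theorem zero_mem_evens : (0 : TorusSite ν L) ∈ evens ν L := by
  simp [evens, StaggeredDeterminant.eoParity]

/-- **The site inequality at `β ≥ 0`**: `(N - 2νκ) S_β(1) ≤ (N e^{βc} K(λ(β)) + κ) ∑_{b ∋ x} S_β((σσ)_b)` (`x` even,
`1 ≤ N ≤ 4`, every `β ≥ 0` with `κ(β) < N e^{-βc}`, every even `L`). [cite: SalmhoferSeiler1991, Thm. 4.8 (4.38)] -/
theorem site_bound (hL : Even L) (hN1 : 1 ≤ N) (hN4 : N ≤ 4) {β : ℝ} (hβ : 0 ≤ β)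
    (hD : kap N ν β < (N : ℝ) * Real.exp (-β * linkOsc ν N)) {x : TorusSite ν L} (hx : x ∈ evens ν L) :
    ((N : ℝ) - 2 * ν * kap N ν β) * sdS N ν L β 1 ≤
      ((N : ℝ) * Real.exp (β * linkOsc ν N) * ComplexSpin.sdKP N (sdLam N ν β) (ComplexSpin.uNLogCoeff N) + kap N ν β) *
        ∑ e ∈ bondsAt ν L x, sdS N ν L β (spinPair (torusLinks ν L e).1 (torusLinks ν L e).2) := by
  have hlog : ComplexSpin.HasLog N (ComplexSpin.uNBondCoeff N) (ComplexSpin.uNLogCoeff N) := ComplexSpin.hasLog_uN hN1 hN4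
  have h := sd_base hL hN1 hβ hx hlog (uNLogCoeff_nonneg' hN4)
  refine h.trans ?_
  rw [Finset.mul_sum]
  refine Finset.sum_le_sum fun e he => ?_
  have hb := sum_le_sdKP_bond hL hN1 hN4 hβ hD hx he
  have hpos : 0 ≤ (N : ℝ) * Real.exp (β * linkOsc ν N) := by positivity
  nlinarith [mul_le_mul_of_nonneg_left hb hpos]

/-! ### The bonds at a site, enumerated by direction and orientation -/

variable (ν L) in
/-- The link at `x` in direction `μ`, forward (`(x, μ)`) or backward (`(x - e_μ, μ)`). [cite: SalmhoferSeiler1991, (3.46)] -/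
def bondOf (x : TorusSite ν L) (s : Fin ν × Bool) : Edge ν L :=
  if s.2 then (x, s.1) else (x - Pi.single s.1 1, s.1)

omit [NeZero L] [LinearOrder (TorusSite ν L)] in
/-- On a torus of side `L ≥ 2`, `e_μ ≠ 0`. [cite: SalmhoferSeiler1991, §2 (2.1)] -/
theorem single_ne_zero (hL : 1 < L) (μ : Fin ν) : (Pi.single μ (1 : ZMod L) : TorusSite ν L) ≠ 0 := by
  haveI : Fact (1 < L) := ⟨hL⟩
  intro h
  have := congrFun h μ
  simp at this

omit [NeZero L] [LinearOrder (TorusSite ν L)] in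
/-- The enumeration is injective. [cite: SalmhoferSeiler1991, (3.46)] -/
theorem bondOf_injective (hL : 1 < L) (x : TorusSite ν L) : Function.Injective (bondOf ν L x) := by
  have hne := single_ne_zero (ν := ν) hL
  have hs2 : ∀ s : Fin ν × Bool, (bondOf ν L x s).2 = s.1 := fun s => by unfold bondOf; split_ifs <;> rfl
  rintro ⟨μ, b⟩ ⟨μ', b'⟩ h
  have h2 : μ = μ' := by simpa [hs2] using congrArg Prod.snd h
  subst h2
  have h1 := congrArg Prod.fst h
  cases b <;> cases b'
  · rfl
  · simp only [bondOf, Bool.false_eq_true, if_false, if_true] at h1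
    exact absurd (sub_eq_self.mp h1) (hne μ)
  · simp only [bondOf, Bool.false_eq_true, if_false, if_true] at h1
    exact absurd (sub_eq_self.mp h1.symm) (hne μ)
  · rfl

omit [LinearOrder (TorusSite ν L)] in
/-- The enumeration is onto the bonds at `x`. [cite: SalmhoferSeiler1991, (3.46)] -/
theorem image_bondOf (x : TorusSite ν L) : Finset.univ.image (bondOf ν L x) = bondsAt ν L x := by
  ext ℓ
  rw [Finset.mem_image, mem_bondsAt]
  constructor
  · rintro ⟨⟨μ, b⟩, -, rfl⟩
    cases b
    · right; simp [bondOf, torusLinks]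
    · left; simp [bondOf, torusLinks]
  · rintro (h | h)
    · refine ⟨(ℓ.2, true), Finset.mem_univ _, ?_⟩
      simp only [bondOf, if_true]
      exact Prod.ext h.symm rfl
    · refine ⟨(ℓ.2, false), Finset.mem_univ _, ?_⟩
      simp only [bondOf]
      refine Prod.ext ?_ rfl
      simp only [torusLinks] at h
      exact (eq_sub_of_add_eq h).symm

omit [LinearOrder (TorusSite ν L)] in
/-- `∑_{b ∋ x} f(b) = ∑_μ (f(x, μ) + f(x - e_μ, μ))` (side `L ≥ 2`). [cite: SalmhoferSeiler1991, (3.46)] -/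
theorem sum_bondsAt {M : Type*} [AddCommMonoid M] (hL : 1 < L) (x : TorusSite ν L) (f : Edge ν L → M) :
    ∑ e ∈ bondsAt ν L x, f e = ∑ μ : Fin ν, (f (x, μ) + f (x - Pi.single μ 1, μ)) := by
  classical
  rw [← image_bondOf, Finset.sum_image fun s _ t _ h => bondOf_injective hL x h, Fintype.sum_prod_type]
  refine Finset.sum_congr rfl fun μ _ => ?_
  rw [Fintype.sum_bool]
  simp [bondOf]

/-! ### The Schwinger–Dyson lower bound at `β ≥ 0`, uniformly in the volume -/

/-- **THE SCHWINGER–DYSON LOWER BOUND AT `β ≥ 0`, UNIFORMLY IN THE VOLUME (row S4).**  For `1 ≤ N ≤ 4`, `ν ≥ 1`,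
every `β ≥ 0` with `κ(β) < N e^{-βc}` (a condition on `β, N, ν` only) and EVERY even `L`:
`∑_μ (T_β(e_μ) + T_β(-e_μ)) ≥ b(β) = (2N)² (N - 2νκ(β))/(N e^{βc} K(λ(β)) + κ(β))`, `T_β = ssTwoPoint N ν L β 0 0`;
`b(0) = (2N)²/K(N)` is Salmhofer–Seiler's constant. [cite: SalmhoferSeiler1991, Thm. 4.8 (4.38)–(4.39)] -/
theorem schwingerDyson_bound (hN1 : 1 ≤ N) (hN4 : N ≤ 4) (hν : 1 ≤ ν) (hL : Even L) {β : ℝ} (hβ : 0 ≤ β)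
    (hD : kap N ν β < (N : ℝ) * Real.exp (-β * linkOsc ν N)) :
    sdBound N ν β ≤ ∑ μ : Fin ν, (ssTwoPoint N ν L β 0 0 (Pi.single μ 1) + ssTwoPoint N ν L β 0 0 (-Pi.single μ 1)) := by
  haveI : NeZero ν := ⟨by omega⟩
  have hN0 : N ≠ 0 := by omega
  have hL1 : 1 < L := StaggeredRP.one_lt_of_even_neZero hL
  have hS1 := sdS_one_pos (N := N) (ν := ν) (L := L) hL β
  have hsite := site_bound hL hN1 hN4 hβ hD (zero_mem_evens (ν := ν) (L := L))
  rw [sum_bondsAt hL1] at hsite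
  simp only [torusLinks, zero_add, zero_sub, neg_add_cancel] at hsite
  -- in the conjecture's normalisation
  have hterm : ∀ μ : Fin ν, ssTwoPoint N ν L β 0 0 (Pi.single μ 1) + ssTwoPoint N ν L β 0 0 (-Pi.single μ 1) =
      (2 * N : ℝ) ^ 2 * ((sdS N ν L β (spinPair 0 (Pi.single μ 1)) +
        sdS N ν L β (spinPair (-Pi.single μ 1 : TorusSite ν L) 0)) / sdS N ν L β 1) := by
    intro μ
    rw [ssTwoPoint_eq_spinPair hN0 hL, ssTwoPoint_eq_spinPair hN0 hL, spinPair_comm (0 : TorusSite ν L) (-Pi.single μ 1)]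
    ring
  simp_rw [hterm]
  rw [← Finset.mul_sum, ← Finset.sum_div, sdBound]
  refine mul_le_mul_of_nonneg_left ?_ (by positivity)
  have hK0 : 0 ≤ ComplexSpin.sdKP N (sdLam N ν β) (ComplexSpin.uNLogCoeff N) :=
    ComplexSpin.sdKP_nonneg (fun j hj => sdLam_nonneg hβ hD hj) (by rw [ComplexSpin.uNLogCoeff_one]; exact zero_le_one)
      fun k hk2 hkN => ComplexSpin.uNLogCoeff_nonneg hN4 k hk2 hkN
  have hκ := kap_nonneg (N := N) (ν := ν) hβ
  set D : ℝ := (N : ℝ) * Real.exp (β * linkOsc ν N) * ComplexSpin.sdKP N (sdLam N ν β) (ComplexSpin.uNLogCoeff N) + kap N ν β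
  have hD0 : 0 ≤ D := by positivity
  rcases hD0.eq_or_lt with hD0 | hDpos
  · -- degenerate denominator: the bound is `0 ≤ …`
    rw [← hD0, div_zero]
    exact div_nonneg (Finset.sum_nonneg fun μ _ => add_nonneg (sdS_nonneg hL β (isChiralPositive_spinPair_pow _ _ 1) |>.trans_eq
      (by rw [pow_one])) (sdS_nonneg hL β (isChiralPositive_spinPair_pow _ _ 1) |>.trans_eq (by rw [pow_one]))) hS1.le
  · rw [div_le_div_iff₀ hDpos hS1]
    linarith [hsite]

/-! ### The limit `β → 0`: continuity of the explicit constant -/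

omit [NeZero L] [LinearOrder (TorusSite ν L)] in
/-- `κ` is continuous. [cite: SeilerLNP1982, Ch. 2] -/
theorem continuous_kap : Continuous (kap N ν) := by
  unfold kap; fun_prop

omit [NeZero L] [LinearOrder (TorusSite ν L)] in
/-- `λ_j(β) → 1 - j/N` as `β → 0`. [cite: SalmhoferSeiler1991, (4.35)] -/
theorem tendsto_sdLam (hN : N ≠ 0) (j : ℕ) :
    Filter.Tendsto (fun β => sdLam N ν β j) (nhds 0) (nhds (ComplexSpin.sdRate N j)) := by
  have h0 : sdLam N ν 0 j = ComplexSpin.sdRate N j := by rw [sdLam_zero hN]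
  rw [← h0]
  have hk := continuous_kap (N := N) (ν := ν)
  have hc : ContinuousAt (fun β => sdLam N ν β j) 0 := by
    unfold sdLam
    refine ContinuousAt.div (by fun_prop) (by fun_prop) ?_
    rw [kap_zero]; simp [Nat.cast_ne_zero.mpr hN]
  exact hc.tendsto

omit [NeZero L] [LinearOrder (TorusSite ν L)] in
/-- **`b(β) → (2N)²/K(N)` as `β → 0`** (`1 ≤ N ≤ 4`). [cite: SalmhoferSeiler1991, Thm. 4.8 (4.38)–(4.39) with Remark 4.6] -/
theorem tendsto_sdBound (hN1 : 1 ≤ N) (hN4 : N ≤ 4) :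
    Filter.Tendsto (sdBound N ν) (nhds 0) (nhds ((2 * N : ℝ) ^ 2 / ComplexSpin.sdK N (ComplexSpin.uNLogCoeff N))) := by
  have hN0 : N ≠ 0 := by omega
  have hw1 : ComplexSpin.uNLogCoeff N 1 = 1 := ComplexSpin.uNLogCoeff_one N
  have hwk : ∀ k, 2 ≤ k → k ≤ N → 0 ≤ ComplexSpin.uNLogCoeff N k := fun k hk2 hkN => ComplexSpin.uNLogCoeff_nonneg hN4 k hk2 hkN
  have hK1 : 1 ≤ ComplexSpin.sdK N (ComplexSpin.uNLogCoeff N) := ComplexSpin.one_le_sdK hN1 hw1 hwk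
  have hKP : Filter.Tendsto (fun β => ComplexSpin.sdKP N (sdLam N ν β) (ComplexSpin.uNLogCoeff N)) (nhds 0)
      (nhds (ComplexSpin.sdK N (ComplexSpin.uNLogCoeff N))) := by
    rw [← ComplexSpin.sdKP_rate]
    exact ComplexSpin.tendsto_sdKP (tendsto_sdLam hN0) (fun j hj => ComplexSpin.sdRate_nonneg hN1 hj) hwk
  have hκ : Filter.Tendsto (kap N ν) (nhds 0) (nhds 0) := by
    have := (continuous_kap (N := N) (ν := ν)).tendsto 0; rwa [kap_zero] at this
  have hexp : Filter.Tendsto (fun β : ℝ => Real.exp (β * linkOsc ν N)) (nhds 0) (nhds 1) := by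
    have : Continuous fun β : ℝ => Real.exp (β * linkOsc ν N) := by fun_prop
    have h := this.tendsto 0; simpa using h
  have hnum : Filter.Tendsto (fun β => (N : ℝ) - 2 * ν * kap N ν β) (nhds 0) (nhds (N : ℝ)) := by
    have := (tendsto_const_nhds : Filter.Tendsto (fun _ : ℝ => (N : ℝ)) (nhds 0) (nhds (N : ℝ))).sub (hκ.const_mul (2 * (ν : ℝ)))
    simpa using this
  have hden : Filter.Tendsto (fun β => (N : ℝ) * Real.exp (β * linkOsc ν N) *
      ComplexSpin.sdKP N (sdLam N ν β) (ComplexSpin.uNLogCoeff N) + kap N ν β) (nhds 0)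
      (nhds ((N : ℝ) * ComplexSpin.sdK N (ComplexSpin.uNLogCoeff N))) := by
    have := ((hexp.const_mul (N : ℝ)).mul hKP).add hκ; simpa using this
  have hlim : (2 * N : ℝ) ^ 2 / ComplexSpin.sdK N (ComplexSpin.uNLogCoeff N) =
      (2 * N : ℝ) ^ 2 * ((N : ℝ) / ((N : ℝ) * ComplexSpin.sdK N (ComplexSpin.uNLogCoeff N))) := by
    have hN' : (N : ℝ) ≠ 0 := Nat.cast_ne_zero.mpr hN0
    field_simp
  rw [hlim]
  exact (hnum.div hden (by positivity)).const_mul _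

/-- **ROW S4 AT SMALL `β > 0` IS A THEOREM, UNIFORMLY IN THE VOLUME**: for `1 ≤ N ≤ 4`, `ν ≥ 1` and every
`ε > 0` there is `β₁ > 0` (depending on `N, ν, ε` only) such that for all `0 ≤ β < β₁` and ALL even `L`
the Schwinger–Dyson bound (SD)_{β,(2N)²/K(N) - ε} holds:
`(2N)²/K(N) - ε ≤ ∑_μ (T_β(e_μ) + T_β(-e_μ))`, `T_β = ssTwoPoint N ν L β 0 0` — the lower-semicontinuity
half of `salmhoferSeilerSmallBeta_of_semicontinuous_bounds`, now unconditional. [cite: SalmhoferSeiler1991, Thm. 4.8 (4.38) with Remark 4.6] -/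
theorem schwingerDysonBound_smallBeta (hN1 : 1 ≤ N) (hN4 : N ≤ 4) (hν : 1 ≤ ν) {ε : ℝ} (hε : 0 < ε) :
    ∃ β₁ : ℝ, 0 < β₁ ∧ ∀ β : ℝ, 0 ≤ β → β < β₁ → ∀ (L : ℕ) [NeZero L], Even L →
      (2 * N : ℝ) ^ 2 / ComplexSpin.sdK N (ComplexSpin.uNLogCoeff N) - ε ≤
        ∑ μ : Fin ν, (ssTwoPoint N ν L β 0 0 (Pi.single μ 1) + ssTwoPoint N ν L β 0 0 (-Pi.single μ 1)) := by
  have hN0 : N ≠ 0 := by omega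
  obtain ⟨δ₁, hδ₁, h₁⟩ := Metric.tendsto_nhds_nhds.mp (tendsto_sdBound (ν := ν) hN1 hN4) ε hε
  -- validity of the estimates: `κ(β) < N e^{-βc}` near `β = 0`
  have hg : Filter.Tendsto (fun β => (N : ℝ) * Real.exp (-β * linkOsc ν N) - kap N ν β) (nhds 0) (nhds (N : ℝ)) := by
    have hc : Continuous fun β => (N : ℝ) * Real.exp (-β * linkOsc ν N) - kap N ν β := by
      have := continuous_kap (N := N) (ν := ν); fun_prop
    have h := hc.tendsto 0
    simpa [kap_zero] using h
  obtain ⟨δ₂, hδ₂, h₂⟩ := Metric.tendsto_nhds_nhds.mp hg ((N : ℝ) / 2) (by positivity)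
  refine ⟨min δ₁ δ₂, lt_min hδ₁ hδ₂, fun β hβ hβ1 L _ hL => ?_⟩
  letI : LinearOrder (TorusSite ν L) :=
    LinearOrder.lift' (Fintype.equivFin (TorusSite ν L)) (Fintype.equivFin (TorusSite ν L)).injective
  have hd1 : dist β 0 < δ₁ := by rw [dist_zero_right, Real.norm_eq_abs, abs_of_nonneg hβ]; exact hβ1.trans_le (min_le_left _ _)
  have hd2 : dist β 0 < δ₂ := by rw [dist_zero_right, Real.norm_eq_abs, abs_of_nonneg hβ]; exact hβ1.trans_le (min_le_right _ _)
  have hb := h₁ hd1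
  rw [Real.dist_eq] at hb
  have hv := h₂ hd2
  rw [Real.dist_eq] at hv
  have hD : kap N ν β < (N : ℝ) * Real.exp (-β * linkOsc ν N) := by
    have := (abs_lt.mp hv).1; linarith
  have hmain := schwingerDyson_bound (L := L) hN1 hN4 hν hL hβ hD
  have := (abs_lt.mp hb).1
  linarith

/-- **REDUCTION OF Y3 TO THE INFRARED BOUND ALONE.**  `SalmhoferSeilerSmallBeta` follows as soon as, for every
`1 ≤ N ≤ 4`, `ν ≥ 4`, `ε > 0`, there are `β₁ > 0` and `L₀` with the infrared bound (IR)_{β,4N+ε} (row S3) for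
the conjecture's kernel at all `0 ≤ β < β₁` and all even `L ≥ L₀` — the Schwinger–Dyson half (row S4) of
`salmhoferSeilerSmallBeta_of_semicontinuous_bounds` being supplied by `schwingerDysonBound_smallBeta`.  What
remains open is exactly the volume-uniform upper semicontinuity at `β = 0⁺` of the infrared constant
(Gaussian domination at `β > 0`; not in print). [cite: SalmhoferSeiler1991, Thm. 4.8 and Cor. 4.9 with (4.41)–(4.42)] -/
theorem salmhoferSeilerSmallBeta_of_infraredBound
    (h : ∀ N ν : ℕ, 1 ≤ N → N ≤ 4 → 4 ≤ ν → ∀ ε : ℝ, 0 < ε →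
      ∃ β₁ : ℝ, 0 < β₁ ∧ ∃ L₀ : ℕ, ∀ β : ℝ, 0 ≤ β → β < β₁ → ∀ (L : ℕ) [NeZero L], Even L → L₀ ≤ L →
        ∀ χ : AddChar (TorusSite ν L) ℂ, -(ν : ℝ) < ComplexSpin.cosSum χ → ComplexSpin.cosSum χ < ν →
          2 * ((ν : ℝ) - ComplexSpin.cosSum χ) *
              (ComplexSpin.kernelSymbol (fun x y => ssTwoPoint N ν L β 0 x y) χ).re ≤ 4 * N + ε ∧
            2 * ((ν : ℝ) + ComplexSpin.cosSum χ) *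
              (-(ComplexSpin.kernelSymbol (fun x y => ssTwoPoint N ν L β 0 x y) χ).re) ≤ 4 * N + ε) :
    SalmhoferSeilerSmallBeta := by
  refine salmhoferSeilerSmallBeta_of_semicontinuous_bounds fun N ν hN1 hN4 hν ε hε => ?_
  obtain ⟨β₁, hβ₁, L₀, hIR⟩ := h N ν hN1 hN4 hν ε hε
  obtain ⟨β₂, hβ₂, hSD⟩ := schwingerDysonBound_smallBeta (ν := ν) hN1 hN4 (by omega) hε
  exact ⟨min β₁ β₂, lt_min hβ₁ hβ₂, L₀, fun β hβ hβlt L _ hL hLL =>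
    ⟨hIR β hβ (hβlt.trans_le (min_le_left _ _)) L hL hLL, hSD β hβ (hβlt.trans_le (min_le_right _ _)) L hL⟩⟩

end SchwingerDyson

end Summit.Ventures.YMGap.Conjectures
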